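import Literature.Probability.LatticeModels.LatticeLaplacian
import Mathlib.Combinatorics.SimpleGraph.Walk.Operations
import HarnessLib

/-!
# Harmonic extension on finite subsets of `ℤ²`: the solution operator and support propagation

Topic `Literature/Probability/LatticeModels` (discrete potential theory on `ℤ²`, continuing
`LatticeLaplacian.lean`); an instalment (item P5 of the road recorded in `Sweep1Proofs.lean`,
module docstring §2b) of the discharge programme for crit-ising.S18 / Smirnov's Theorem 2.2. The
weak Beurling estimate is proved analytically, with harmonic extensions standing in for
random-walk hitting probabilities; this file packages the solution operator of the discrete
Dirichlet problem (`harmExt U g`, from `exists_isLatticeHarmonicOn_eq_off`) with its comparison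
principles, and proves the one qualitative fact about supports that replaces "a positive hitting
probability is witnessed by a path": if a function harmonic on a finite `U` is positive at
`x ∈ U`, a lattice walk along which it stays positive leads from `x` out of `U`
(`exists_walk_pos_of_harmonic_pos`). Everything is proved and `[folklore]`.

* `harmExt`, `harmExt_harmonicOn`, `harmExt_of_not_mem`, `harmExt_le`, `le_harmExt`,
  `harmExt_le'`, `le_harmExt'`, `harmExt_le_of_superharmonic`, `le_harmExt_of_subharmonic`.
* `exists_walk_pos_of_harmonic_pos`.

## References

* S. Smirnov, Ann. of Math. 172 (2010) 1435–1467, App. B — bib key `Smirnov2010`.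
-/

noncomputable section

namespace Literature.Probability.LatticeModels

open Set

/-! ### The harmonic extension operator -/

/-- **The harmonic extension** of data `g` into a finite set `U ⊆ ℤ²`: the unique function that is
lattice-harmonic on `U` and equal to `g` off `U` (`exists_isLatticeHarmonicOn_eq_off`); for
infinite `U` the junk value `g`. In random-walk terms, `harmExt U g x = E_x[g(X_τ)]`, `τ` the exit
time of `U`. [folklore] -/
def harmExt (U : Set (Site 2)) (g : Site 2 → ℝ) : Site 2 → ℝ :=
  open scoped Classical in
  if hU : U.Finite then Classical.choose (exists_isLatticeHarmonicOn_eq_off hU g) else g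

/-- The harmonic extension is harmonic on `U`. [folklore] -/
theorem harmExt_harmonicOn {U : Set (Site 2)} (hU : U.Finite) (g : Site 2 → ℝ) :
    IsLatticeHarmonicOn (harmExt U g) U := by
  rw [harmExt, dif_pos hU]; exact (Classical.choose_spec (exists_isLatticeHarmonicOn_eq_off hU g)).1

/-- The harmonic extension equals the data off `U`. [folklore] -/
theorem harmExt_of_not_mem {U : Set (Site 2)} (hU : U.Finite) (g : Site 2 → ℝ) {w : Site 2} (hw : w ∉ U) :
    harmExt U g w = g w := by
  rw [harmExt, dif_pos hU]; exact (Classical.choose_spec (exists_isLatticeHarmonicOn_eq_off hU g)).2 w hw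

/-- **Upper bound**: if the data are `≤ M` on the outer boundary then `harmExt ≤ M` on `U`. [folklore] -/
theorem harmExt_le {U : Set (Site 2)} (hU : U.Finite) {g : Site 2 → ℝ} {M : ℝ}
    (hg : ∀ w ∈ latticeOuterBoundary U, g w ≤ M) {x : Site 2} (hx : x ∈ U) : harmExt U g x ≤ M :=
  (harmExt_harmonicOn hU g).subharmonicOn.le_of_forall_boundary_le hU
    (fun w hw => by rw [harmExt_of_not_mem hU g hw.1]; exact hg w hw) x hx

/-- **Lower bound**: if the data are `≥ M` on the outer boundary then `harmExt ≥ M` on `U`. [folklore] -/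
theorem le_harmExt {U : Set (Site 2)} (hU : U.Finite) {g : Site 2 → ℝ} {M : ℝ}
    (hg : ∀ w ∈ latticeOuterBoundary U, M ≤ g w) {x : Site 2} (hx : x ∈ U) : M ≤ harmExt U g x :=
  (harmExt_harmonicOn hU g).superharmonicOn.ge_of_forall_boundary_ge hU
    (fun w hw => by rw [harmExt_of_not_mem hU g hw.1]; exact hg w hw) x hx

/-- Upper bound everywhere, for data bounded everywhere. [folklore] -/
theorem harmExt_le' {U : Set (Site 2)} (hU : U.Finite) {g : Site 2 → ℝ} {M : ℝ} (hg : ∀ w, g w ≤ M) (x : Site 2) :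
    harmExt U g x ≤ M := by
  by_cases hx : x ∈ U
  · exact harmExt_le hU (fun w _ => hg w) hx
  · rw [harmExt_of_not_mem hU g hx]; exact hg x

/-- Lower bound everywhere, for data bounded below everywhere. [folklore] -/
theorem le_harmExt' {U : Set (Site 2)} (hU : U.Finite) {g : Site 2 → ℝ} {M : ℝ} (hg : ∀ w, M ≤ g w) (x : Site 2) :
    M ≤ harmExt U g x := by
  by_cases hx : x ∈ U
  · exact le_harmExt hU (fun w _ => hg w) hx
  · rw [harmExt_of_not_mem hU g hx]; exact hg x

/-- **Comparison with a superharmonic majorant**: if `V` is superharmonic on `U` and `g ≤ V` on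
the outer boundary of `U`, then `harmExt U g ≤ V` on `U`. [folklore] -/
theorem harmExt_le_of_superharmonic {U : Set (Site 2)} (hU : U.Finite) {g V : Site 2 → ℝ}
    (hV : IsLatticeSuperharmonicOn V U) (hb : ∀ w ∈ latticeOuterBoundary U, g w ≤ V w) {x : Site 2} (hx : x ∈ U) :
    harmExt U g x ≤ V x := by
  have := le_of_sub_super_of_boundary hU (harmExt_harmonicOn hU g).subharmonicOn hV (c := 0)
    (fun w hw => by rw [harmExt_of_not_mem hU g hw.1, add_zero]; exact hb w hw) x hx
  rwa [add_zero] at this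

/-- **Comparison with a subharmonic minorant.** [folklore] -/
theorem le_harmExt_of_subharmonic {U : Set (Site 2)} (hU : U.Finite) {g V : Site 2 → ℝ}
    (hV : IsLatticeSubharmonicOn V U) (hb : ∀ w ∈ latticeOuterBoundary U, V w ≤ g w) {x : Site 2} (hx : x ∈ U) :
    V x ≤ harmExt U g x := by
  have := le_of_sub_super_of_boundary hU hV (harmExt_harmonicOn hU g).superharmonicOn (c := 0)
    (fun w hw => by rw [harmExt_of_not_mem hU g hw.1, add_zero]; exact hb w hw) x hx
  rwa [add_zero] at this

/-! ### Support propagation: positivity reaches the boundary along a positive path -/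

/-- **Support propagation.** Let `u` be lattice-harmonic on a finite set `U` and positive at
`x ∈ U`. Then there is a lattice walk from `x` to a site `w ∉ U` along which `u` is positive and
all of whose sites other than `w` lie in `U` (the maximiser of `u` over the positively reachable set
would otherwise propagate to infinity). In random-walk terms: `E_x[u(X_τ)] > 0` forces a path to
an exit point with `u > 0`. [folklore] -/
theorem exists_walk_pos_of_harmonic_pos {U : Set (Site 2)} (hU : U.Finite) {u : Site 2 → ℝ}
    (hu : IsLatticeHarmonicOn u U) {x : Site 2} (hx : x ∈ U) (hpos : 0 < u x) :
    ∃ w, w ∉ U ∧ 0 < u w ∧ ∃ p : (zdGraph 2).Walk x w, ∀ z ∈ p.support, 0 < u z ∧ (z ∈ U ∨ z = w) := by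
  classical
  -- the positively reachable set
  set Reach : Set (Site 2) := {z | ∃ p : (zdGraph 2).Walk x z, ∀ y ∈ p.support, 0 < u y ∧ (y ∈ U ∨ y = z)} with hReach
  by_contra hno
  push Not at hno
  -- every reachable point lies in `U`
  have hRU : Reach ⊆ U := by
    intro z ⟨p, hp⟩
    by_contra hzU
    have hz := hp z (SimpleGraph.Walk.end_mem_support p)
    obtain ⟨y, hy, himp⟩ := hno z hzU hz.1 p
    have hy' := hp y hy
    rcases hy'.2 with h | h
    · exact (himp hy'.1).1 h
    · exact (himp hy'.1).2 h
  have hxR : x ∈ Reach := ⟨SimpleGraph.Walk.nil, fun y hy => by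
    rw [SimpleGraph.Walk.support_nil, List.mem_singleton] at hy; subst hy; exact ⟨hpos, Or.inl hx⟩⟩
  have hRfin : Reach.Finite := hU.subset hRU
  have hRpos : ∀ z ∈ Reach, 0 < u z := fun z ⟨p, hp⟩ => (hp z (SimpleGraph.Walk.end_mem_support p)).1
  -- extension of reachability along a positive neighbour
  have hext : ∀ z ∈ Reach, ∀ k : Fin 4, 0 < u (z + cornerUnit k) → z + cornerUnit k ∈ Reach := by
    rintro z ⟨p, hp⟩ k hk
    have hzU : z ∈ U := hRU ⟨p, hp⟩
    have hadj : (zdGraph 2).Adj z (z + cornerUnit k) := by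
      rw [zdGraph_adj_iff]
      fin_cases k
      · exact ⟨0, Or.inl rfl⟩
      · exact ⟨1, Or.inl rfl⟩
      · exact ⟨0, Or.inr (by simp [cornerUnit])⟩
      · exact ⟨1, Or.inr (by simp [cornerUnit])⟩
    refine ⟨p.append (SimpleGraph.Walk.cons hadj SimpleGraph.Walk.nil), fun y hy => ?_⟩
    rw [SimpleGraph.Walk.support_append] at hy
    rcases List.mem_append.1 hy with hy | hy
    · obtain ⟨h1, h2⟩ := hp y hy
      refine ⟨h1, Or.inl ?_⟩
      rcases h2 with h2 | rfl
      · exact h2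
      · exact hzU
    · simp only [SimpleGraph.Walk.support_cons, SimpleGraph.Walk.support_nil, List.tail_cons,
        List.mem_singleton] at hy
      subst hy; exact ⟨hk, Or.inr rfl⟩
  -- a maximiser over `Reach` has all four neighbours in `Reach` with the same value
  have hstep : ∀ z ∈ Reach, (∀ y ∈ Reach, u y ≤ u z) → ∀ k : Fin 4, z + cornerUnit k ∈ Reach ∧ u (z + cornerUnit k) = u z := by
    intro z hz hmax
    have hzU := hRU hz
    -- harmonic at `z`: the Laplacian vanishes, and every neighbour is `≤ u z`
    have hle : ∀ k : Fin 4, u (z + cornerUnit k) ≤ u z := by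
      intro k
      by_contra hgt; push Not at hgt
      have hposk : 0 < u (z + cornerUnit k) := (hRpos z hz).trans hgt
      exact absurd (hmax _ (hext z hz k hposk)) (not_le.2 hgt)
    have hlap := hu z hzU
    rw [latticeLaplacian_eq, Fin.sum_univ_four] at hlap
    have h0 := hle 0
    have h1 := hle 1
    have h2 := hle 2
    have h3 := hle 3
    have heq : ∀ k : Fin 4, u (z + cornerUnit k) = u z := by
      intro k
      fin_cases k
      · show u (z + cornerUnit 0) = u z; linarith
      · show u (z + cornerUnit 1) = u z; linarith
      · show u (z + cornerUnit 2) = u z; linarith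
      · show u (z + cornerUnit 3) = u z; linarith
    intro k
    exact ⟨hext z hz k (by rw [heq k]; exact hRpos z hz), heq k⟩
  -- a maximiser exists; propagate it to the right forever
  obtain ⟨z₀, hz₀, hmax⟩ := Set.exists_max_image Reach u hRfin ⟨x, hxR⟩
  have hprop : ∀ n : ℕ, z₀ + (n : ℤ) • cornerUnit 0 ∈ Reach ∧ u (z₀ + (n : ℤ) • cornerUnit 0) = u z₀ := by
    intro n
    induction n with
    | zero => simpa using hz₀
    | succ n ih =>
      have hmaxn : ∀ y ∈ Reach, u y ≤ u (z₀ + (n : ℤ) • cornerUnit 0) := by rw [ih.2]; exact hmax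
      have := hstep _ ih.1 hmaxn 0
      rw [add_assoc, ← add_one_zsmul] at this
      push_cast
      exact ⟨this.1, this.2.trans ih.2⟩
  -- infinitely many points of the finite set `Reach`
  have hinj : Function.Injective fun n : ℕ => z₀ + (n : ℤ) • cornerUnit 0 := by
    intro n n' h
    have := congrArg (fun v : Site 2 => v 0) h
    simp [cornerUnit] at this
    exact_mod_cast this
  exact (Set.infinite_of_injective_forall_mem hinj fun n => (hprop n).1) hRfin

end Literature.Probability.LatticeModels
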